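import Summits.QuantumFields.YangMills.Theorems.BalabanUVNodesPortU8GenericRowOn
import Summits.QuantumFields.YangMills.Theorems.BalabanUVNodesPortU8CurrentLinearisation
import Summits.QuantumFields.YangMills.Theorems.BalabanUVNodesPortU8Response9
import Summits.QuantumFields.YangMills.Theorems.BalabanUVNodesPortS1Selector
import Summits.QuantumFields.YangMills.Theorems.BalabanUVNodesK0RecordFormatNamesLemmas11

/-!
# PORT PT-B (U8), g3 file 1 — THE ROWS OF 27931 ⁷⁗ «v10-Loc» FOR THE CHART-UNIT □₀-LOCALIZED RESPONSE `recordGkLocWξ W` AT AN ARBITRARY WINDOW `W`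
# (edition-robust: v11-Loc only re-binds the radii): `𝐔`-block = `Matrix.of (recordHrLocξ W a y b)`; CLOSED FORM of the linearised localized current
# `recordJLocξ W a y b = ξ⁻³·(−i)·π(d*d HrLocξ)(b)` (port M ✓p799978 at `W_t := exp(t·HrLocξ) ∈ SU(2)`); `𝐉`-bound from clause 4; ROW (R1ᴰ-Loc) at one
# (volume, domain, label, window) from the four (190)-clauses ON THE BONDS OF `X` (✓GenericRowOn p805597); rows (R3)(R5) for `recordResponse9DataFromLocAtξ`.

Cell `ym-nodeO-ideate` ∕ `ym-balaban-port`, porter `ymgap-nodeO-port-PTB-1` (gen 3), item **stmt-QuantumFields-27931** `BalabanUVNodes.PortPieceLocalityU8`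
(text of record ⁷⁗ «v10-Loc» `d796c7a1386a82f1`; director-ym №495: V11 BUILD = GO, CLOSE = HOLD).  `--supports stmt-QuantumFields-27931` (helper; closes nothing).
[I] = [Balaban1987RG1], [15] = [Balaban1985Variational], [B6] = [Balaban1984PropagatorsII].

WHAT THIS FILE PROVES (theorems only; no `def ∕ instance ∕ notation ∕ sorry`; standard axioms), at the record's fill `θ := thetaFill F a₀ ε₂₉` (`ρ₈ = suChartMap 2`:
skew-Hermitian TRACELESS values, so `exp(t·ρ₈v) ∈ SU(2)` honestly):
* §1 `trace_ρ8_thetaFill`, `matrixOf_recordHrLocξ` (`Matrix.of (HrLocξ W a l b) = ξ·windowResp W l b • ρ₈(bV a)`), `trace_matrixOf_recordHrLocξ = 0`, `exp_smul_matrixOf_recordHrLocξ_mem`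
  (`exp (t • HrLocξ(b)) ∈ SU(2)`).
* §2 THE LINE `t ↦ δ_l ⊗ t·bV a` through the chart-unit localized configuration: `coe_recordCfgLocξ_line` (`= exp (t • HrLocξ(b))` as a matrix), `recordCfgLocξ_line_zero` (`= 1`),
  `hasDerivAt_recordCfgLocξ_line` (derivative `HrLocξ(b)` at `t = 0`).
* §3 ★★ `recordJLocξ_eq` — THE CLOSED FORM: `recordJLocξ W a l b = ξ⁻³·(−i)·π(Σ_ν [(dH)(p_{μν}(x)) − (dH)(p_{μν}(x − e_ν))])`, `H = Matrix.of ∘ HrLocξ`, `b = (x, μ)` — [I] (1.8)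
  linearised at the flat background along the localized configuration (✓`hasDerivAt_current_one` + `current_lin_eq`, entry by entry); `trace_recordJLocξ = 0`.
* §4 the blocks of the CUT data: `recordGkLocWξ_inl ∕ _inr`, ★ `chartMatU_cutTo_recordGkLocWξ` (`= Matrix.of (HrLocξ … b)` on `b ∈ X`, `0` off), ★ `chartMatJc_cutTo_recordGkLocWξ`
  (`= JLocξ … b` on `X`, `0` off), ★★ `norm_chartMatJc_cutTo_recordGkLocWξ_le` (`≤ 2‖π_ℝ‖ξ⁻³·t` from the clause-4 bound `t` at `b`).
* §5 ★★★ `rowR1D_Loc_at` — ROW (R1ᴰ-Loc) at one `(K, X, y, W)`: the four scaled (190)-clauses for `Hr := recordHrLocξ W a y` AT EVERY BOND OF `X` ⟹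
  `gauge (recordDom44J X α₂) (cutTo (recordCXJ X) (recordGkLocWξ W a y)) ≤ 2(2C + 2‖π_ℝ‖C + 1)e^{4δ₉Mc}∕α₂ · e^{−δ₉·dist(y, X)}` — uniform in `k, K, X, y, W`.
* §6 rows (R3)(R5) for `recordResponse9DataFromLocAtξ` (its index ∕ lift ∕ chart fields ARE `…FromJ`'s: ✓p796246 by name) and the FRAME `response9DLocW_fromLocAtξ_of_decayRows`
  (`Response9DLocW` from (R1ᴰ-Loc) and (R4ᴰ-Loc) in the record's letters, any guards `inner`, `nowrap`).

HONEST FRAMING.  Lattice calculus and bookkeeping at the names of ed.16c; the decay of the window response (the TokP9L4-Loc token) and the two-volume TRANSPORT row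
(R4ᴰ-Loc) are NOT proved here; NOTHING of Bałaban's analysis is asserted, ported or discharged; 27931 OPEN · SIGNED v10-Loc · close on HOLD (№495); K0⁷ NOT closed;
NODE O 0∕1; COUNT 8∕28 · K 1∕4 UNMOVED; finite `𝕋⁴_{L^K}` at fixed ε — NOT continuum ∕ OS ∕ Clay; **the Yang–Mills mass gap (Clay) is NOT proved by any of this.**
-/

noncomputable section

open scoped BigOperators Matrix.Norms.L2Operator
open Complex (I)

namespace Summit.QuantumFields.YangMills.Theorems.PortU8

open Literature.MathematicalPhysics.QuantumFieldTheory.Balaban1983to89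
open Literature.MathematicalPhysics.QuantumFieldTheory.Balaban1983to89.Node00
open Literature.MathematicalPhysics.QuantumFieldTheory.Balaban1983to89.T4Continuum (T4Family)
open Literature.MathematicalPhysics.QuantumFieldTheory.Balaban1983to89.B12Eq18Current (current)
open Summit.QuantumFields.YangMills.Theorems.K0RecordFormatNames
open Summit.QuantumFields.YangMills.Theorems.BalabanUVNodesPortS1 (trace_sl2Proj exp_ρ8_thetaFill_mem)
open NormedSpace (exp)

variable (F : T4Family) (a₀ ε₂₉ : ℝ)

/-! ## §1  At the fill: `ρ₈` is traceless; the matrix of `HrLocξ`; `exp(t·HrLocξ(b)) ∈ SU(2)` -/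

/-- At the fill `ρ₈ = suChartMap 2` has TRACELESS values. [cite: Balaban1987RG1, p.264 (before (1.20)); Hall2015, Example 7.3] -/
theorem trace_ρ8_thetaFill (v : (thetaFill F a₀ ε₂₉).Vβ) :
    letI θ := thetaFill F a₀ ε₂₉; letI := θ.instVβ₁; letI := θ.instVβ₂
    (θ.ρ8 v).trace = 0 := by
  letI θ := thetaFill F a₀ ε₂₉; letI := θ.instVβ₁; letI := θ.instVβ₂
  have hρ : (θ.ρ8 : θ.Vβ → Matrix (Fin 2) (Fin 2) ℂ) = (suChartMap 2 : (Fin (suChartDim 2) → ℝ) → Matrix (Fin 2) (Fin 2) ℂ) := rfl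
  have hv : θ.ρ8 v = suChartMap 2 v := congrFun hρ v
  rw [hv]
  exact (suChartMap_mem 2 v).2

/-- At the fill `ρ₈ v ∈ 𝔰𝔲(2)` (skew-Hermitian and traceless). [cite: Balaban1987RG1, p.264 (before (1.20)); Hall2015, Example 7.3] -/
theorem ρ8_thetaFill_mem_lieSU (v : (thetaFill F a₀ ε₂₉).Vβ) :
    letI θ := thetaFill F a₀ ε₂₉; letI := θ.instVβ₁; letI := θ.instVβ₂
    θ.ρ8 v ∈ T4AdjointCovarianceUnitary.lieSU (Fin 2) := by
  letI θ := thetaFill F a₀ ε₂₉; letI := θ.instVβ₁; letI := θ.instVβ₂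
  have hρ : (θ.ρ8 : θ.Vβ → Matrix (Fin 2) (Fin 2) ℂ) = (suChartMap 2 : (Fin (suChartDim 2) → ℝ) → Matrix (Fin 2) (Fin 2) ℂ) := rfl
  have hv : θ.ρ8 v = suChartMap 2 v := congrFun hρ v
  have h := suChartMap_mem 2 v
  rw [hv]
  exact T4AdjointCovarianceUnitary.mem_lieSU_iff.mpr ⟨by rw [Matrix.star_eq_conjTranspose]; exact h.1, h.2⟩

/-- **The matrix of the chart-unit localized response on a bond**: `Matrix.of (HrLocξ W a l b) = (ξ·windowResp W l b) • ρ₈(bV a) = ρ₈((ξ·windowResp W l b) • bV a)`.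
[cite: Balaban1987RG1, (3.37) p.277, (4.35) p.290 (bookkeeping)] -/
theorem matrixOf_recordHrLocξ (k K : ℕ) (W : Finset (Site (F.P K) (k + 1))) (a : (thetaFill F a₀ ε₂₉).ιβ) (l : RespLabel F k K) (b : PBond (F.P K) 0) :
    letI θ := thetaFill F a₀ ε₂₉; letI := θ.instVβ₁; letI := θ.instVβ₂; letI := θ.instιβ
    (Matrix.of fun i i' => recordHrLocξ F θ k K W a l b i i') = θ.ρ8 (windowRespξ F k K W l b • θ.bV a) := by
  letI θ := thetaFill F a₀ ε₂₉; letI := θ.instVβ₁; letI := θ.instVβ₂; letI := θ.instιβ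
  ext i i'
  rw [map_smul, Matrix.of_apply, Matrix.smul_apply, Complex.real_smul]
  rfl

/-- The matrix of `HrLocξ` on a bond is TRACELESS. [cite: Balaban1987RG1, (3.37) p.277 (bookkeeping)] -/
theorem trace_matrixOf_recordHrLocξ (k K : ℕ) (W : Finset (Site (F.P K) (k + 1))) (a : (thetaFill F a₀ ε₂₉).ιβ) (l : RespLabel F k K) (b : PBond (F.P K) 0) :
    letI θ := thetaFill F a₀ ε₂₉; letI := θ.instVβ₁; letI := θ.instVβ₂; letI := θ.instιβ
    (Matrix.of fun i i' => recordHrLocξ F θ k K W a l b i i' : MatA 2).trace = 0 := by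
  rw [matrixOf_recordHrLocξ]
  exact trace_ρ8_thetaFill F a₀ ε₂₉ _

/-- `exp (t • HrLocξ(b)) ∈ SU(2)` for real `t` (`t • ρ₈ w = ρ₈ (t • w) ∈ 𝔰𝔲(2)`). [cite: Balaban1987RG1, (3.37) p.277; Hall2015, Example 7.3] -/
theorem exp_smul_matrixOf_recordHrLocξ_mem (k K : ℕ) (W : Finset (Site (F.P K) (k + 1))) (a : (thetaFill F a₀ ε₂₉).ιβ) (l : RespLabel F k K)
    (b : PBond (F.P K) 0) (t : ℝ) :
    letI θ := thetaFill F a₀ ε₂₉; letI := θ.instVβ₁; letI := θ.instVβ₂; letI := θ.instιβ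
    exp (t • (Matrix.of fun i i' => recordHrLocξ F θ k K W a l b i i' : MatA 2)) ∈ Matrix.specialUnitaryGroup (Fin 2) ℂ := by
  letI θ := thetaFill F a₀ ε₂₉; letI := θ.instVβ₁; letI := θ.instVβ₂; letI := θ.instιβ
  rw [matrixOf_recordHrLocξ, ← map_smul]
  exact exp_ρ8_thetaFill_mem F a₀ ε₂₉ _

/-! ## §2  The line `t ↦ δ_l ⊗ t·bV a` through the chart-unit localized configuration -/

/-- On the line `B_t = δ_l ⊗ t·bV a` the chart-unit linear representation is `t • HrLocξ(b)` bondwise. [cite: Balaban1987RG1, (4.2) p.281, (3.37) p.277 (bookkeeping)] -/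
theorem recordALocξ_line (k K : ℕ) (W : Finset (Site (F.P K) (k + 1))) (a : (thetaFill F a₀ ε₂₉).ιβ) (l : RespLabel F k K) (b : PBond (F.P K) 0) (t : ℝ) :
    letI θ := thetaFill F a₀ ε₂₉; letI := θ.instVβ₁; letI := θ.instVβ₂; letI := θ.instιβ
    recordALocξ F θ k K W (Pi.single l.1 (Pi.single l.2 (t • θ.bV a))) b = t • (Matrix.of fun i i' => recordHrLocξ F θ k K W a l b i i' : MatA 2) := by
  letI θ := thetaFill F a₀ ε₂₉; letI := θ.instVβ₁; letI := θ.instVβ₂; letI := θ.instιβ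
  rw [recordALocξ_single, matrixOf_recordHrLocξ, map_smul, map_smul, smul_comm, Complex.coe_smul]

/-- **`W_t(b) = exp(t • HrLocξ(b))` AS A MATRIX** on the line (the retraction `suOfMat` is the identity on `SU(2)`). [cite: Balaban1987RG1, (3.37) p.277, (4.2) p.281] -/
theorem coe_recordCfgLocξ_line (k K : ℕ) (W : Finset (Site (F.P K) (k + 1))) (a : (thetaFill F a₀ ε₂₉).ιβ) (l : RespLabel F k K) (b : PBond (F.P K) 0) (t : ℝ) :
    letI θ := thetaFill F a₀ ε₂₉; letI := θ.instVβ₁; letI := θ.instVβ₂; letI := θ.instιβ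
    ((recordCfgLocξ F θ k K W (Pi.single l.1 (Pi.single l.2 (t • θ.bV a))) b : SU 2) : MatA 2) =
      exp (t • (Matrix.of fun i i' => recordHrLocξ F θ k K W a l b i i' : MatA 2)) := by
  letI θ := thetaFill F a₀ ε₂₉; letI := θ.instVβ₁; letI := θ.instVβ₂; letI := θ.instιβ
  have h : recordCfgLocξ F θ k K W (Pi.single l.1 (Pi.single l.2 (t • θ.bV a))) b =
      suOfMat 2 (exp (recordALocξ F θ k K W (Pi.single l.1 (Pi.single l.2 (t • θ.bV a))) b)) := rfl
  rw [h, recordALocξ_line, suOfMat_of_mem (exp_smul_matrixOf_recordHrLocξ_mem F a₀ ε₂₉ k K W a l b t)]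

/-- The units-valued line `W_t(b) := ιSU (recordCfgLocξ W B_t b)` as a matrix. [cite: Balaban1987RG1, (1.8)–(1.9) p.261 (bookkeeping)] -/
theorem coe_ιSU_recordCfgLocξ_line (k K : ℕ) (W : Finset (Site (F.P K) (k + 1))) (a : (thetaFill F a₀ ε₂₉).ιβ) (l : RespLabel F k K) (b : PBond (F.P K) 0)
    (t : ℝ) :
    letI θ := thetaFill F a₀ ε₂₉; letI := θ.instVβ₁; letI := θ.instVβ₂; letI := θ.instιβ
    ((ιSU 2 (recordCfgLocξ F θ k K W (Pi.single l.1 (Pi.single l.2 (t • θ.bV a))) b) : (MatA 2)ˣ) : MatA 2) =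
      exp (t • (Matrix.of fun i i' => recordHrLocξ F θ k K W a l b i i' : MatA 2)) := by
  rw [← coe_recordCfgLocξ_line]
  rfl

/-- `W_0 = 1`. [cite: Balaban1987RG1, (3.37) p.277 (bookkeeping)] -/
theorem ιSU_recordCfgLocξ_line_zero (k K : ℕ) (W : Finset (Site (F.P K) (k + 1))) (a : (thetaFill F a₀ ε₂₉).ιβ) (l : RespLabel F k K) (b : PBond (F.P K) 0) :
    letI θ := thetaFill F a₀ ε₂₉; letI := θ.instVβ₁; letI := θ.instVβ₂; letI := θ.instιβ
    ιSU 2 (recordCfgLocξ F θ k K W (Pi.single l.1 (Pi.single l.2 ((0 : ℝ) • θ.bV a))) b) = 1 := by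
  apply Units.ext
  rw [coe_ιSU_recordCfgLocξ_line, zero_smul, NormedSpace.exp_zero, Units.val_one]

/-- **`(W_t(b))′(0) = HrLocξ(b)`** (derivative of `u ↦ exp(u • X)` at `0`). [cite: Balaban1987RG1, (3.37) p.277, (4.35) p.290] -/
theorem hasDerivAt_ιSU_recordCfgLocξ_line (k K : ℕ) (W : Finset (Site (F.P K) (k + 1))) (a : (thetaFill F a₀ ε₂₉).ιβ) (l : RespLabel F k K)
    (b : PBond (F.P K) 0) :
    letI θ := thetaFill F a₀ ε₂₉; letI := θ.instVβ₁; letI := θ.instVβ₂; letI := θ.instιβ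
    HasDerivAt (fun t : ℝ => ((ιSU 2 (recordCfgLocξ F θ k K W (Pi.single l.1 (Pi.single l.2 (t • θ.bV a))) b) : (MatA 2)ˣ) : MatA 2))
      (Matrix.of fun i i' => recordHrLocξ F θ k K W a l b i i' : MatA 2) 0 := by
  letI θ := thetaFill F a₀ ε₂₉; letI := θ.instVβ₁; letI := θ.instVβ₂; letI := θ.instιβ
  have h := hasDerivAt_exp_smul_const' (𝕂 := ℝ) (Matrix.of fun i i' => recordHrLocξ F θ k K W a l b i i' : MatA 2) (0 : ℝ)
  simp only [zero_smul, NormedSpace.exp_zero, mul_one] at h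
  refine h.congr_of_eventuallyEq (Filter.Eventually.of_forall fun t => ?_)
  exact coe_ιSU_recordCfgLocξ_line F a₀ ε₂₉ k K W a l b t

/-! ## §3  The closed form of the linearised localized current `recordJLocξ` -/

/-- ★★ **THE LINEARISED CURRENT OF THE LOCALIZED CONFIGURATION, CLOSED FORM**: with `H(b') := Matrix.of (recordHrLocξ W a l b')` and `b = (x, μ)`,
`recordJLocξ W a l b = ξ⁻³·(−i)·π (Σ_ν [(H(x,μ) + H(x+e_μ,ν) − H(x+e_ν,μ) − H(x,ν)) − (H(x−e_ν,μ) + H(x−e_ν+e_μ,ν) − H(x−e_ν+e_ν,μ) − H(x−e_ν,ν))])` — [I] (1.8)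
differentiated at the flat background along `W_t = exp(t·H)` (port M ✓`hasDerivAt_current_one`, `current_lin_eq`), read entry by entry.
[cite: Balaban1987RG1, (1.8) p.261, (3.24) p.275, (4.35) p.290; Balaban1985BackgroundPropagators, (3.4), (3.9) pp.391–392] -/
theorem recordJLocξ_eq (k K : ℕ) (W : Finset (Site (F.P K) (k + 1))) (a : (thetaFill F a₀ ε₂₉).ιβ) (l : RespLabel F k K) (b : PBond (F.P K) 0) :
    letI θ := thetaFill F a₀ ε₂₉; letI := θ.instVβ₁; letI := θ.instVβ₂; letI := θ.instιβ
    letI H : PBond (F.P K) 0 → MatA 2 := fun b' => Matrix.of fun i i' => recordHrLocξ F θ k K W a l b' i i'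
    recordJLocξ F θ k K W a l b =
      ((((F.P K).eta (k + 1) : ℂ)⁻¹) ^ 3) • ((-I) • sl2Proj (∑ ν : Fin (F.P K).d,
        ((H ⟨b.src, b.dir⟩ + H ⟨b.src.shift b.dir, ν⟩ - H ⟨b.src.shift ν, b.dir⟩ - H ⟨b.src, ν⟩) -
          (H ⟨b.src.unshift ν, b.dir⟩ + H ⟨(b.src.unshift ν).shift b.dir, ν⟩ - H ⟨(b.src.unshift ν).shift ν, b.dir⟩ - H ⟨b.src.unshift ν, ν⟩)))) := by
  letI θ := thetaFill F a₀ ε₂₉; letI := θ.instVβ₁; letI := θ.instVβ₂; letI := θ.instιβ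
  set H : PBond (F.P K) 0 → MatA 2 := fun b' => Matrix.of fun i i' => recordHrLocξ F θ k K W a l b' i i' with hH
  -- the units-valued line and its derivative
  set Wt : ℝ → PBond (F.P K) 0 → (MatA 2)ˣ := fun t b' => ιSU 2 (recordCfgLocξ F θ k K W (Pi.single l.1 (Pi.single l.2 (t • θ.bV a))) b') with hWt
  have h1 : ∀ b', Wt 0 b' = 1 := fun b' => ιSU_recordCfgLocξ_line_zero F a₀ ε₂₉ k K W a l b'
  have hW : ∀ b', HasDerivAt (fun t : ℝ => (Wt t b' : MatA 2)) (H b') 0 := fun b' => hasDerivAt_ιSU_recordCfgLocξ_line F a₀ ε₂₉ k K W a l b'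
  have hJ := hasDerivAt_current_one h1 hW sl2Proj ((F.P K).eta (k + 1)) b
  rw [current_lin_eq] at hJ
  -- the pair's second component on the line IS `current sl2Proj ξ (Wt t)`
  have hpair : ∀ t : ℝ, (recordPairLocξ F θ k K W (Pi.single l.1 (Pi.single l.2 (t • θ.bV a)))).2 = current sl2Proj ((F.P K).eta (k + 1)) (Wt t) := fun t => rfl
  ext i i'
  obtain ⟨E, hE⟩ := exists_entryCLM i i'
  have hcomp := (E.hasFDerivAt.comp_hasDerivAt 0 hJ)
  have hfun : (fun t : ℝ => (recordPairLocξ F θ k K W (Pi.single l.1 (Pi.single l.2 (t • θ.bV a)))).2 b i i') =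
      (fun A : MatA 2 => E A) ∘ fun t : ℝ => current sl2Proj ((F.P K).eta (k + 1)) (Wt t) b := by
    funext t; rw [Function.comp_apply, hE, hpair]
  show deriv (fun t : ℝ => (recordPairLocξ F θ k K W (Pi.single l.1 (Pi.single l.2 (t • θ.bV a)))).2 b i i') 0 = _
  rw [hfun, hcomp.deriv, hE]

/-- The linearised localized current is TRACELESS (`π = sl2Proj`). [cite: Balaban1987RG1, (1.8) p.261 (bookkeeping)] -/
theorem trace_recordJLocξ (k K : ℕ) (W : Finset (Site (F.P K) (k + 1))) (a : (thetaFill F a₀ ε₂₉).ιβ) (l : RespLabel F k K) (b : PBond (F.P K) 0) :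
    (recordJLocξ F (thetaFill F a₀ ε₂₉) k K W a l b).trace = 0 := by
  rw [recordJLocξ_eq, Matrix.trace_smul, Matrix.trace_smul, trace_sl2Proj, smul_zero, smul_zero]

/-! ## §4  The blocks of the cut chart-unit localized data -/

section Blocks

variable (θ : Stage13Params F 2)

/-- The `𝐔`-coordinates of `recordGkLocWξ`. [cite: Balaban1987RG1, (4.35) p.290 (bookkeeping)] -/
theorem recordGkLocWξ_inl (k K : ℕ) (W : Finset (Site (F.P K) (k + 1))) (a : θ.ιβ) (l : RespLabel F k K) (b : PBond (F.P K) 0) (c : Fin 3) :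
    recordGkLocWξ F θ k K W a l (chartEquivJ F K (b, Sum.inl c)) = sl2Coord (Matrix.of fun i i' => recordHrLocξ F θ k K W a l b i i') c := by
  simp [recordGkLocWξ]

/-- The `𝐉`-coordinates of `recordGkLocWξ`. [cite: Balaban1987RG1, (4.35) p.290 (bookkeeping)] -/
theorem recordGkLocWξ_inr (k K : ℕ) (W : Finset (Site (F.P K) (k + 1))) (a : θ.ιβ) (l : RespLabel F k K) (b : PBond (F.P K) 0) (c : Fin 3) :
    recordGkLocWξ F θ k K W a l (chartEquivJ F K (b, Sum.inr c)) = sl2Coord (recordJLocξ F θ k K W a l b) c := by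
  simp [recordGkLocWξ]

end Blocks

open scoped Classical in
/-- ★ **`𝐔`-BLOCK OF THE CUT LOCALIZED DATA = `Matrix.of (HrLocξ … b)` on `b ∈ X`**, `0` off `X` (traceless at the fill). [cite: Balaban1987RG1, (4.4) p.281, (4.35) p.290] -/
theorem chartMatU_cutTo_recordGkLocWξ (k K : ℕ) (W : Finset (Site (F.P K) (k + 1))) (a : (thetaFill F a₀ ε₂₉).ιβ) (y : RespLabel F k K)
    {Mc : ℕ} (X : (recordDomSys F Mc k K).Dom) (b : PBond (F.P K) 0) :
    chartMatU F K (B12FormatPlus.cutTo (recordCXJ F Mc k K X) (recordGkLocWξ F (thetaFill F a₀ ε₂₉) k K W a y)) b =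
      if b ∈ domBonds F Mc k K X then Matrix.of (fun i i' => recordHrLocξ F (thetaFill F a₀ ε₂₉) k K W a y b i i') else 0 := by
  classical
  have hmem : ∀ c : Fin 3, chartEquivJ F K (b, Sum.inl c) ∈ recordCXJ F Mc k K X ↔ b ∈ domBonds F Mc k K X := fun c => by simp [recordCXJ]
  by_cases hb : b ∈ domBonds F Mc k K X
  · rw [if_pos hb, ← sum_sl2Coord_smul_sl2Gen_of_trace_eq_zero (trace_matrixOf_recordHrLocξ F a₀ ε₂₉ k K W a y b)]
    unfold chartMatU
    refine Finset.sum_congr rfl fun c _ => ?_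
    rw [B12FormatPlus.cutTo_apply, if_pos ((hmem c).2 hb), recordGkLocWξ_inl]
  · rw [if_neg hb]
    unfold chartMatU
    refine Finset.sum_eq_zero fun c _ => ?_
    rw [B12FormatPlus.cutTo_apply, if_neg (mt (hmem c).1 hb), zero_smul]

open scoped Classical in
/-- ★ **`𝐉`-BLOCK OF THE CUT LOCALIZED DATA = `recordJLocξ … b` on `b ∈ X`**, `0` off `X` (traceless: `π = sl2Proj`). [cite: Balaban1987RG1, (1.8)–(1.9) p.261, (4.4) p.281] -/
theorem chartMatJc_cutTo_recordGkLocWξ (k K : ℕ) (W : Finset (Site (F.P K) (k + 1))) (a : (thetaFill F a₀ ε₂₉).ιβ) (y : RespLabel F k K)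
    {Mc : ℕ} (X : (recordDomSys F Mc k K).Dom) (b : PBond (F.P K) 0) :
    chartMatJc F K (B12FormatPlus.cutTo (recordCXJ F Mc k K X) (recordGkLocWξ F (thetaFill F a₀ ε₂₉) k K W a y)) b =
      if b ∈ domBonds F Mc k K X then recordJLocξ F (thetaFill F a₀ ε₂₉) k K W a y b else 0 := by
  classical
  have hmem : ∀ c : Fin 3, chartEquivJ F K (b, Sum.inr c) ∈ recordCXJ F Mc k K X ↔ b ∈ domBonds F Mc k K X := fun c => by simp [recordCXJ]
  by_cases hb : b ∈ domBonds F Mc k K X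
  · rw [if_pos hb, ← sum_sl2Coord_smul_sl2Gen_of_trace_eq_zero (trace_recordJLocξ F a₀ ε₂₉ k K W a y b)]
    unfold chartMatJc
    refine Finset.sum_congr rfl fun c _ => ?_
    rw [B12FormatPlus.cutTo_apply, if_pos ((hmem c).2 hb), recordGkLocWξ_inr]
  · rw [if_neg hb]
    unfold chartMatJc
    refine Finset.sum_eq_zero fun c _ => ?_
    rw [B12FormatPlus.cutTo_apply, if_neg (mt (hmem c).1 hb), zero_smul]

/-- ★★ **THE `𝐉`-BLOCK OF THE CUT LOCALIZED DATA BOUNDED BY THE FOURTH (190)-CLAUSE ON `HrLocξ`**: if the lattice `d*d Hr` at `b = (x, μ) ∈ X` —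
`Σ_ν [(dHr)(p_{μν}(x)) − (dHr)(p_{μν}(x − e_ν))]`, `Hr = recordHrLocξ W a y` — has sup-entry norm `≤ t`, then `‖chartMatJc (cutTo (recordCXJ X) (recordGkLocWξ W a y)) b‖ ≤ 2·‖π_ℝ‖·ξ⁻³·t`.
[cite: Balaban1987RG1, (1.8) p.261, (4.4) p.281; Balaban1985Variational, (190) p.308 (fourth line)] -/
theorem norm_chartMatJc_cutTo_recordGkLocWξ_le (k K : ℕ) (W : Finset (Site (F.P K) (k + 1))) (a : (thetaFill F a₀ ε₂₉).ιβ) (y : RespLabel F k K)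
    {Mc : ℕ} (X : (recordDomSys F Mc k K).Dom) (b : PBond (F.P K) 0) (hb : b ∈ domBonds F Mc k K X) {t : ℝ}
    (h4 : letI Hr := recordHrLocξ F (thetaFill F a₀ ε₂₉) k K W a y;
      ‖∑ ν : Fin (F.P K).d, ((Hr ⟨b.src, b.dir⟩ + Hr ⟨(b.src).shift b.dir, ν⟩ - Hr ⟨(b.src).shift ν, b.dir⟩ - Hr ⟨b.src, ν⟩) -
        (Hr ⟨b.src.unshift ν, b.dir⟩ + Hr ⟨(b.src.unshift ν).shift b.dir, ν⟩ - Hr ⟨(b.src.unshift ν).shift ν, b.dir⟩ - Hr ⟨b.src.unshift ν, ν⟩))‖ ≤ t) :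
    ‖chartMatJc F K (B12FormatPlus.cutTo (recordCXJ F Mc k K X) (recordGkLocWξ F (thetaFill F a₀ ε₂₉) k K W a y)) b‖ ≤
      2 * ‖LinearMap.toContinuousLinearMap (sl2Proj.restrictScalars ℝ)‖ * (((F.P K).eta (k + 1))⁻¹) ^ 3 * t := by
  rw [chartMatJc_cutTo_recordGkLocWξ, if_pos hb, recordJLocξ_eq]
  obtain ⟨e, he⟩ := exists_ofCLM
  set Hr := recordHrLocξ F (thetaFill F a₀ ε₂₉) k K W a y with hHr
  have hcurl : ∀ ν : Fin (F.P K).d,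
      ((Matrix.of fun i i' => Hr ⟨b.src, b.dir⟩ i i' : MatA 2) + Matrix.of (fun i i' => Hr ⟨b.src.shift b.dir, ν⟩ i i') -
          Matrix.of (fun i i' => Hr ⟨b.src.shift ν, b.dir⟩ i i') - Matrix.of (fun i i' => Hr ⟨b.src, ν⟩ i i')) -
        (Matrix.of (fun i i' => Hr ⟨b.src.unshift ν, b.dir⟩ i i') + Matrix.of (fun i i' => Hr ⟨(b.src.unshift ν).shift b.dir, ν⟩ i i') -
          Matrix.of (fun i i' => Hr ⟨(b.src.unshift ν).shift ν, b.dir⟩ i i') - Matrix.of (fun i i' => Hr ⟨b.src.unshift ν, ν⟩ i i')) =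
      e ((Hr ⟨b.src, b.dir⟩ + Hr ⟨(b.src).shift b.dir, ν⟩ - Hr ⟨(b.src).shift ν, b.dir⟩ - Hr ⟨b.src, ν⟩) -
        (Hr ⟨b.src.unshift ν, b.dir⟩ + Hr ⟨(b.src.unshift ν).shift b.dir, ν⟩ - Hr ⟨(b.src.unshift ν).shift ν, b.dir⟩ - Hr ⟨b.src.unshift ν, ν⟩)) := by
    intro ν
    rw [he]
    rfl
  have hsum : (∑ ν : Fin (F.P K).d,
      (((Matrix.of fun i i' => Hr ⟨b.src, b.dir⟩ i i' : MatA 2) + Matrix.of (fun i i' => Hr ⟨b.src.shift b.dir, ν⟩ i i') -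
          Matrix.of (fun i i' => Hr ⟨b.src.shift ν, b.dir⟩ i i') - Matrix.of (fun i i' => Hr ⟨b.src, ν⟩ i i')) -
        (Matrix.of (fun i i' => Hr ⟨b.src.unshift ν, b.dir⟩ i i') + Matrix.of (fun i i' => Hr ⟨(b.src.unshift ν).shift b.dir, ν⟩ i i') -
          Matrix.of (fun i i' => Hr ⟨(b.src.unshift ν).shift ν, b.dir⟩ i i') - Matrix.of (fun i i' => Hr ⟨b.src.unshift ν, ν⟩ i i')))) =
      e (∑ ν : Fin (F.P K).d, ((Hr ⟨b.src, b.dir⟩ + Hr ⟨(b.src).shift b.dir, ν⟩ - Hr ⟨(b.src).shift ν, b.dir⟩ - Hr ⟨b.src, ν⟩) -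
        (Hr ⟨b.src.unshift ν, b.dir⟩ + Hr ⟨(b.src.unshift ν).shift b.dir, ν⟩ - Hr ⟨(b.src.unshift ν).shift ν, b.dir⟩ - Hr ⟨b.src.unshift ν, ν⟩))) := by
    rw [map_sum]
    exact Finset.sum_congr rfl fun ν _ => hcurl ν
  rw [hsum]
  have hξ : 0 < (F.P K).eta (k + 1) := by
    unfold Params.eta
    exact pow_pos (inv_pos.2 (F.P K).cast_L_pos) _
  refine (norm_current_lin_le sl2Proj hξ _).trans ?_
  rw [he]
  have h2 := (norm_of_le_two_mul_norm _).trans (mul_le_mul_of_nonneg_left h4 zero_le_two)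
  have hπ0 : 0 ≤ (((F.P K).eta (k + 1))⁻¹) ^ 3 * ‖LinearMap.toContinuousLinearMap (sl2Proj.restrictScalars ℝ)‖ := by positivity
  calc (((F.P K).eta (k + 1))⁻¹) ^ 3 * ‖LinearMap.toContinuousLinearMap (sl2Proj.restrictScalars ℝ)‖ * ‖(Matrix.of _ : MatA 2)‖
      ≤ (((F.P K).eta (k + 1))⁻¹) ^ 3 * ‖LinearMap.toContinuousLinearMap (sl2Proj.restrictScalars ℝ)‖ * (2 * t) := mul_le_mul_of_nonneg_left h2 hπ0
    _ = 2 * ‖LinearMap.toContinuousLinearMap (sl2Proj.restrictScalars ℝ)‖ * (((F.P K).eta (k + 1))⁻¹) ^ 3 * t := by ring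

/-! ## §5  ROW (R1ᴰ-Loc) for the chart-unit localized data at one (volume, domain, label, window) from the four clauses ON THE BONDS OF `X` -/

variable {F} in
/-- ★★★ **ROW (R1ᴰ-Loc) FOR THE CHART-UNIT □₀-LOCALIZED RESPONSE** at one volume `K` (tiled range), domain `X`, label `y`, window `W`: if `Hr := recordHrLocξ W a y` obeys the
four scaled clauses of (190) — value `Cη·e_b`, first differences `Cη²·e_b`, Laplacian `Cη³·e_b`, lattice `d*d` `Cη³·e_b`, `e_b = e^{−δ₉·tdist(coarsen b₋, y₀)}` — AT EVERY BOND OF `X`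
(v10-Loc's TokP9L4-Loc token, whose guard «coarse source in □₃» holds on the bonds of `X` under (R1ᴰ-Loc)'s inner guard), then
`gauge (recordDom44J … X α₂) (cutTo (recordCXJ … X) (recordGkLocWξ W a y)) ≤ 2(2C + 2‖π_ℝ‖C + 1)e^{4δ₉Mc}∕α₂ · e^{−δ₉·dist(y, X)}` — uniform in `k, K, X, y, W`.
[cite: Balaban1987RG1, (4.4)–(4.5) pp.281–282, (4.35) p.290; Balaban1985Variational, (190) p.308] -/
theorem rowR1D_Loc_at {Mc k K : ℕ} (hMc : McGuard F Mc) (hK : recordK₀ F Mc k ≤ K) (a₀ ε₂₉ : ℝ) (W : Finset (Site (F.P K) (k + 1)))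
    (a : (thetaFill F a₀ ε₂₉).ιβ) (y : RespLabel F k K) (X : (recordDomSys F Mc k K).Dom) {α₂ C δ₉ : ℝ} (hα : 0 < α₂) (hC : 0 ≤ C) (hδ : 0 ≤ δ₉)
    (hcl : letI Hr := recordHrLocξ F (thetaFill F a₀ ε₂₉) k K W a y;
      ∀ b ∈ domBonds F Mc k K X,
        ‖Hr b‖ ≤ C * (F.P K).eta (k + 1) * Real.exp (-(δ₉ * (Site.tdist (coarsenTo (k + 1) b.src) y.2 : ℝ))) ∧
        (∀ ν : Fin (F.P K).d, ‖Hr ⟨b.src.shift ν, b.dir⟩ - Hr b‖ ≤ C * (F.P K).eta (k + 1) ^ 2 * Real.exp (-(δ₉ * (Site.tdist (coarsenTo (k + 1) b.src) y.2 : ℝ)))) ∧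
        ‖∑ ν : Fin (F.P K).d, (Hr ⟨b.src.shift ν, b.dir⟩ - (2 : ℂ) • Hr b + Hr ⟨b.src.unshift ν, b.dir⟩)‖ ≤
          C * (F.P K).eta (k + 1) ^ 3 * Real.exp (-(δ₉ * (Site.tdist (coarsenTo (k + 1) b.src) y.2 : ℝ))) ∧
        ‖∑ ν : Fin (F.P K).d, ((Hr ⟨b.src, b.dir⟩ + Hr ⟨(b.src).shift b.dir, ν⟩ - Hr ⟨(b.src).shift ν, b.dir⟩ - Hr ⟨b.src, ν⟩) -
          (Hr ⟨b.src.unshift ν, b.dir⟩ + Hr ⟨(b.src.unshift ν).shift b.dir, ν⟩ - Hr ⟨(b.src.unshift ν).shift ν, b.dir⟩ - Hr ⟨b.src.unshift ν, ν⟩))‖ ≤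
          C * (F.P K).eta (k + 1) ^ 3 * Real.exp (-(δ₉ * (Site.tdist (coarsenTo (k + 1) b.src) y.2 : ℝ)))) :
    gauge (recordDom44J F Mc k K X α₂) (B12FormatPlus.cutTo (recordCXJ F Mc k K X) (recordGkLocWξ F (thetaFill F a₀ ε₂₉) k K W a y)) ≤
      2 * (2 * C + 2 * ‖LinearMap.toContinuousLinearMap (sl2Proj.restrictScalars ℝ)‖ * C + 1) * Real.exp (4 * δ₉ * Mc) / α₂ *
        Real.exp (-δ₉ * (recordSiteGeom F Mc k K).distD y X) := by
  have hη0 : 0 < (F.P K).eta (k + 1) := by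
    unfold Params.eta; exact pow_pos (inv_pos.2 (F.P K).cast_L_pos) _
  have hπ0 : 0 ≤ 2 * ‖LinearMap.toContinuousLinearMap (sl2Proj.restrictScalars ℝ)‖ * C := by positivity
  refine gauge_recordDom44J_cutTo_le_of_entryDecayOn F hMc hK X y (recordGkLocWξ F (thetaFill F a₀ ε₂₉) k K W a y)
    (recordHrLocξ F (thetaFill F a₀ ε₂₉) k K W a y) hα hC hπ0 hδ
    (fun b hb => by rw [chartMatU_cutTo_recordGkLocWξ F a₀ ε₂₉ k K W a y X b, if_pos hb])
    (fun b hb => ⟨(hcl b hb).1, (hcl b hb).2.1, (hcl b hb).2.2.1⟩) (fun b hb => ?_)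
  have hM := norm_chartMatJc_cutTo_recordGkLocWξ_le F a₀ ε₂₉ k K W a y X b hb (hcl b hb).2.2.2
  refine hM.trans (le_of_eq ?_)
  have hη3 : ((F.P K).eta (k + 1))⁻¹ ^ 3 * (C * (F.P K).eta (k + 1) ^ 3) = C := by
    field_simp
  calc 2 * ‖LinearMap.toContinuousLinearMap (sl2Proj.restrictScalars ℝ)‖ * ((F.P K).eta (k + 1))⁻¹ ^ 3 *
        (C * (F.P K).eta (k + 1) ^ 3 * Real.exp (-(δ₉ * (Site.tdist (coarsenTo (k + 1) b.src) y.2 : ℝ))))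
      = 2 * ‖LinearMap.toContinuousLinearMap (sl2Proj.restrictScalars ℝ)‖ * (((F.P K).eta (k + 1))⁻¹ ^ 3 * (C * (F.P K).eta (k + 1) ^ 3)) *
          Real.exp (-(δ₉ * (Site.tdist (coarsenTo (k + 1) b.src) y.2 : ℝ))) := by ring
    _ = 2 * ‖LinearMap.toContinuousLinearMap (sl2Proj.restrictScalars ℝ)‖ * C * Real.exp (-(δ₉ * (Site.tdist (coarsenTo (k + 1) b.src) y.2 : ℝ))) := by rw [hη3]

/-! ## §6  Rows (R3)(R5) for the chart-unit localized data from the base volume, and the `Response9DLocW` frame -/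

variable {F} in
/-- Row (R3) for `recordResponse9DataFromLocAtξ` (its `cX ∕ jX ∕ emb ∕ wrap` fields are the record's centred two-block ones: ✓`rowR3_record`).
[cite: Balaban1987RG1, (1.7) p.261, (1.21) p.264] -/
theorem rowR3_fromLocAtξ {Mc : ℕ} (hMc : McGuard F Mc) (θ : Stage13Params F 2) (a : θ.ιβ) (k R0 : ℕ) (z₀ : Fin 4 → ℤ) (n : ℕ)
    (X : (recordDomSys F Mc k (recordK₀ F Mc k + n)).Dom) (hX : X ∉ (recordResponse9DataFromLocAtξ F θ a Mc k (recordK₀ F Mc k) R0 z₀).wrap n)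
    {i : Fin (recordChartDimJ F (recordK₀ F Mc k + n))} (hi : i ∈ (recordResponse9DataFromLocAtξ F θ a Mc k (recordK₀ F Mc k) R0 z₀).cX n X) :
    (recordResponse9DataFromLocAtξ F θ a Mc k (recordK₀ F Mc k) R0 z₀).jX n X i ∈
      (recordResponse9DataFromLocAtξ F θ a Mc k (recordK₀ F Mc k) R0 z₀).cX (n + 1) ((recordResponse9DataFromLocAtξ F θ a Mc k (recordK₀ F Mc k) R0 z₀).emb n X) :=
  rowR3_record hMc (Nat.le_add_right _ _) X hX hi

variable {F} in
/-- Row (R5) for `recordResponse9DataFromLocAtξ` and the two-block chart (✓`rowR5_record`). [cite: Balaban1987RG1, (4.35) p.290, (1.21) p.264] -/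
theorem rowR5_fromLocAtξ {Mc : ℕ} (hMc : McGuard F Mc) (θ : Stage13Params F 2) (a : θ.ιβ) (k R0 : ℕ) (z₀ : Fin 4 → ℤ) (n : ℕ)
    (X : (recordDomSys F Mc k (recordK₀ F Mc k + n)).Dom) (hX : X ∉ (recordResponse9DataFromLocAtξ F θ a Mc k (recordK₀ F Mc k) R0 z₀).wrap n)
    (w' : Fin (recordChartDimJ F (recordK₀ F Mc k + (n + 1))) → ℂ) :
    (recordResponse9DataFromLocAtξ F θ a Mc k (recordK₀ F Mc k) R0 z₀).πc n X (recordChartJ F Mc k (recordK₀ F Mc k + (n + 1))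
        ((recordResponse9DataFromLocAtξ F θ a Mc k (recordK₀ F Mc k) R0 z₀).emb n X) w') =
      recordChartJ F Mc k (recordK₀ F Mc k + n) X
        (B12FormatPlus.restrictCLM ((recordResponse9DataFromLocAtξ F θ a Mc k (recordK₀ F Mc k) R0 z₀).cX n X)
          ((recordResponse9DataFromLocAtξ F θ a Mc k (recordK₀ F Mc k) R0 z₀).jX n X) w') :=
  rowR5_record hMc (Nat.le_add_right _ _) X hX w'

variable {F} in
/-- **THE FRAME — `Response9DLocW` FOR THE CHART-UNIT LOCALIZED DATA FROM ITS TWO DECAY ROWS** (any guards `inner`, `nowrap`): (R0) from the constants' signs, (R3)(R5) by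
✓p796246, (R1ᴰ-Loc) and (R4ᴰ-Loc) displayed in the record's letters. [cite: Balaban1985Variational, Prop. 9 p.309; Balaban1987RG1, (1.21) p.264, (4.35) p.290] -/
theorem response9DLocW_fromLocAtξ_of_decayRows {Mc : ℕ} (hMc : McGuard F Mc) (θ : Stage13Params F 2) (a : θ.ιβ) (k R0 : ℕ) (z₀ : Fin 4 → ℤ) {α₂ C₉ δ₀ : ℝ}
    (inner : (n : ℕ) → RespLabel F k (recordK₀ F Mc k + n) → Prop) (nowrap : ℕ → Prop) (hC : 0 ≤ C₉) (hδ : 0 ≤ δ₀)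
    (hR1 : ∀ (n : ℕ) (X : (recordDomSys F Mc k (recordK₀ F Mc k + n)).Dom) (y : RespLabel F k (recordK₀ F Mc k + n)), nowrap n →
      (∀ i ∈ recordCXJ F Mc k (recordK₀ F Mc k + n) X, inner n (recordSiteOfJ F k (recordK₀ F Mc k + n) i)) →
      gauge (recordDom44J F Mc k (recordK₀ F Mc k + n) X α₂)
        (B12FormatPlus.cutTo (recordCXJ F Mc k (recordK₀ F Mc k + n) X) (recordGkLocAtξ F θ k (recordK₀ F Mc k + n) R0 z₀ a y)) ≤
        C₉ * Real.exp (-δ₀ * (recordSiteGeom F Mc k (recordK₀ F Mc k + n)).distD y X))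
    (hR4 : ∀ (n : ℕ) (X : (recordDomSys F Mc k (recordK₀ F Mc k + n)).Dom), X ∉ recordWrapCtr F Mc k (recordK₀ F Mc k + n) → nowrap n → nowrap (n + 1) →
      ∀ (μ : Fin 4) (z : Fin 4 → ℤ), (∀ l, 2 * |z l| < (recordRNat F Mc k (recordK₀ F Mc k + n) : ℤ)) →
      gauge (recordDom44J F Mc k (recordK₀ F Mc k + n) X α₂)
        (B12FormatPlus.cutTo (recordCXJ F Mc k (recordK₀ F Mc k + n) X) fun i =>
          recordGkLocAtξ F θ k (recordK₀ F Mc k + (n + 1)) R0 z₀ a (recordE F k (recordK₀ F Mc k + (n + 1)) μ z) (recordJXJ F (recordK₀ F Mc k + n) i) -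
            recordGkLocAtξ F θ k (recordK₀ F Mc k + n) R0 z₀ a (recordE F k (recordK₀ F Mc k + n) μ z) i) ≤
        C₉ * Real.exp (-δ₀ * (recordRNat F Mc k (recordK₀ F Mc k + n) : ℝ) / 2) *
          Real.exp (-(δ₀ / 2) * (recordSiteGeom F Mc k (recordK₀ F Mc k + n)).distD (recordE F k (recordK₀ F Mc k + n) μ z) X)) :
    Response9DLocW (recordResponse9DataFromLocAtξ F θ a Mc k (recordK₀ F Mc k) R0 z₀) (fun n => recordChartJ F Mc k (recordK₀ F Mc k + n))
      (fun n => recordRNat F Mc k (recordK₀ F Mc k + n)) (fun n X => recordDom44J F Mc k (recordK₀ F Mc k + n) X α₂) inner nowrap C₉ δ₀ :=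
  ⟨hC, hδ, hR1, fun n X hX _ hi => rowR3_fromLocAtξ hMc θ a k R0 z₀ n X hX hi, hR4, fun n X hX w' => rowR5_fromLocAtξ hMc θ a k R0 z₀ n X hX w'⟩

end Summit.QuantumFields.YangMills.Theorems.PortU8

end
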